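import Summits.ResolutionOfSingularities.ResolutionOfSingularities.Theorems.PurelyInseparableDim4StepKitState
import HarnessLib

/-!
# Purely inseparable fourfolds — STEP KIT (5): a `decide`-able LITERAL-CYCLE checker with soundness
# (cell `res-dim4-pi`, W3-2; complements `…StepKitTrap`)

[OURS · counted 0 · instrument] Nothing here is a statement about resolution of singularities.
A literal cycle of the coordinate game is presented as a non-empty list of rows `(s, S, j, b)`: state,
centre, chart, chart point; row `i` must step LITERALLY onto row `i+1 (mod length)`.  The Boolean
`cycleB cB q C` checks this by structural recursion (the centre passes the Boolean centre test `cB` —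
`anyB` (Hironaka-permissible, MODE 2), `h1B` (MODE 1h), `hpB` ((1) ∧ (2)), `m1B`, `h12B` (1h2) — built on
the kit's `permB / mode1hB / perm2B`, and the edge via `equiB`, non-vanishing and `SData.equivB`), and
**`exists_chain_of_cycleB`** turns `cycleB cB q C = true` (settled by `decide`) into an infinite branch
`∃ c : ℕ → State K, ∀ k, Step q (c k) (c (k+1))` of the corresponding tree step relation, whence
`¬ Terminates1h p q` / `¬ TerminatesM1 p q` / `¬ Terminates1h2 p q` (`not_terminates…_of_cycleB`).
Translated chart points are allowed (the spine-only, support-level cycle certificates are p-8's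
`…SpineCert*`).  No instances; counted 0.
bears_on: LADDER-RESOLUTION:D157-DOOR2 (res-dim4-pi · W3-2). Supports stmt-ResolutionOfSingularities-16155 (helper).
-/

set_option linter.dupNamespace false -- mandated namespace of this single-conjunct summit

noncomputable section

open MvPolynomial Finset

namespace Summit.ResolutionOfSingularities.ResolutionOfSingularities.Theorems.PIDim4

namespace StepKit

open Literature.AlgebraicGeometry.Resolution
open Literature.AlgebraicGeometry.Resolution.CentreBlowup

variable {K : Type} [Field K] [DecidableEq K]

/-! ## §12 Periodic chains -/

/-- A periodic sequence through a non-empty list. [folklore] -/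
def cyc {α : Type} (l : List α) (a : α) (k : ℕ) : α := l.getD (k % l.length) a

omit [Field K] [DecidableEq K] in
/-- **Chain lemma**: if consecutive list entries (cyclically) are related, the periodic sequence is an
infinite chain. [folklore] -/
theorem chain_of_cyclic {α : Type} (R : α → α → Prop) (l : List α) (a : α) (hl : l ≠ [])
    (h : ∀ i (hi : i < l.length), R l[i] (l[(i + 1) % l.length]'(Nat.mod_lt _ (List.length_pos_iff.mpr hl)))) :
    ∀ k, R (cyc l a k) (cyc l a (k + 1)) := by
  intro k
  have hlen : 0 < l.length := List.length_pos_iff.mpr hl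
  have hk : k % l.length < l.length := Nat.mod_lt _ hlen
  have h1 := h (k % l.length) hk
  unfold cyc
  rw [List.getD_eq_getElem?_getD, List.getD_eq_getElem?_getD, List.getElem?_eq_getElem hk,
    List.getElem?_eq_getElem (Nat.mod_lt _ hlen), Option.getD_some, Option.getD_some]
  have : (k % l.length + 1) % l.length = (k + 1) % l.length := by rw [Nat.add_mod, Nat.mod_mod, ← Nat.add_mod]
  simp only [this] at h1
  exact h1

/-! ## §13 Cycle rows and the checker -/

/-- A cycle row: state, centre, chart, chart point. [folklore] -/
abbrev CycRow (K : Type) : Type := SData 4 K × Finset (Fin 4) × Fin 4 × (Fin 4 → K)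

/-- Centre test of MODE 1h (as a function of centre and presented state). [folklore] -/
def h1B (q : ℕ) (S : Finset (Fin 4)) (s : SData 4 K) : Bool := mode1hB q S s.L

/-- Centre test of MODE 2 (Hironaka-permissible). [folklore] -/
def anyB (q : ℕ) (S : Finset (Fin 4)) (s : SData 4 K) : Bool := permB q S s.L

/-- Centre test of conditions (1) ∧ (2). [folklore] -/
def hpB (q : ℕ) (S : Finset (Fin 4)) (s : SData 4 K) : Bool := permB q S s.L && perm2B S s

/-- Centre test of sub-rule m1. [folklore] -/
def m1B (q : ℕ) (S : Finset (Fin 4)) (s : SData 4 K) : Bool :=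
  permB q S s.L && perm2B S s &&
    decide (∀ S' : Finset (Fin 4), permB q S' s.L = true → perm2B S' s = true → S.card ≤ S'.card)

/-- Centre test of sub-rule 1h2. [folklore] -/
def h12B (q : ℕ) (S : Finset (Fin 4)) (s : SData 4 K) : Bool :=
  permB q S s.L &&
    decide (((∃ S' : Finset (Fin 4), permB q S' s.L = true ∧ perm2B S' s = true) → perm2B S s = true) ∧
      ∀ S' : Finset (Fin 4), permB q S' s.L = true →
        ((∃ S'' : Finset (Fin 4), permB q S'' s.L = true ∧ perm2B S'' s = true) → perm2B S' s = true) →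
          S.card ≤ S'.card)

/-- One row (with centre test `cB`) steps literally onto the state `t`. [folklore] -/
def rowB (cB : Finset (Fin 4) → SData 4 K → Bool) (q : ℕ) (r : CycRow K) (t : SData 4 K) : Bool :=
  cB r.2.1 r.1 && decide (r.2.2.1 ∈ r.2.1) && decide (r.2.2.2 r.2.2.1 = 0) &&
    equiB q r.2.1 r.2.2.1 r.2.2.2 r.1 && !(StepKit.equivB (stepD q r.2.1 r.2.2.1 r.2.2.2 r.1).L []) &&
    (stepD q r.2.1 r.2.2.1 r.2.2.2 r.1).equivB t

/-- **The cycle checker** (centre test `cB`): non-empty, and every row steps literally onto the next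
row's state (cyclically). [folklore] -/
def cycleB (cB : Finset (Fin 4) → SData 4 K → Bool) (q : ℕ) (C : List (CycRow K)) : Bool :=
  !C.isEmpty && (List.range C.length).all fun i =>
    match C[i]?, C[(i + 1) % C.length]? with
    | some r, some r' => rowB cB q r r'.1
    | _, _ => false

/-- Soundness of one row: the centre test holds and the edge exists. [folklore] -/
theorem edge_of_rowB {cB : Finset (Fin 4) → SData 4 K → Bool} {q : ℕ} {r : CycRow K} {t : SData 4 K}
    (h : rowB cB q r t = true) : cB r.2.1 r.1 = true ∧ Edge q r.2.1 r.1.toState t.toState := by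
  simp only [rowB, Bool.and_eq_true, decide_eq_true_eq, Bool.not_eq_true'] at h
  obtain ⟨⟨⟨⟨⟨hc, hj⟩, hb⟩, h1⟩, h2⟩, h3⟩ := h
  exact ⟨hc, edge_of r.2.2.1 r.2.2.2 hj hb h1 h2 h3⟩

/-- **Soundness of the cycle checker**, for any step relation `P` implied by (centre test ∧ edge). [folklore] -/
theorem exists_chain_of_cycleB {cB : Finset (Fin 4) → SData 4 K → Bool} {q : ℕ} {P : State K → State K → Prop}
    (hP : ∀ (r : CycRow K) (t : SData 4 K), cB r.2.1 r.1 = true → Edge q r.2.1 r.1.toState t.toState →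
      P r.1.toState t.toState)
    {C : List (CycRow K)} (h : cycleB cB q C = true) : ∃ c : ℕ → State K, ∀ k, P (c k) (c (k + 1)) := by
  simp only [cycleB, Bool.and_eq_true, Bool.not_eq_true', List.isEmpty_eq_false_iff, List.all_eq_true,
    List.mem_range] at h
  obtain ⟨hne, hall⟩ := h
  obtain ⟨r₀, _⟩ := List.exists_mem_of_ne_nil C hne
  refine ⟨fun k => (cyc C r₀ k).1.toState,
    chain_of_cyclic (fun r r' : CycRow K => P r.1.toState r'.1.toState) C r₀ hne fun i hi => ?_⟩
  have h := hall i hi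
  have hlen : 0 < C.length := List.length_pos_iff.mpr hne
  rw [List.getElem?_eq_getElem hi, List.getElem?_eq_getElem (Nat.mod_lt _ hlen)] at h
  obtain ⟨hc, hedge⟩ := edge_of_rowB h
  exact hP _ _ hc hedge

/-- **MODE-1h cycle ⇒ infinite MODE-1h branch.** [folklore] -/
theorem exists_step1h_chain_of_cycleB {q : ℕ} {C : List (CycRow K)} (h : cycleB (h1B q) q C = true) :
    ∃ c : ℕ → State K, ∀ k, Step1h q (c k) (c (k + 1)) :=
  exists_chain_of_cycleB (fun r _ hc he => ⟨r.2.1, (isMode1hCentre_iff q r.2.1 r.1.L).mpr hc, he⟩) h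

/-- MODE-2 cycle ⇒ infinite MODE-2 branch. [folklore] -/
theorem exists_step2_chain_of_cycleB {q : ℕ} {C : List (CycRow K)} (h : cycleB (anyB q) q C = true) :
    ∃ c : ℕ → State K, ∀ k, Step2 q (c k) (c (k + 1)) :=
  exists_chain_of_cycleB (fun r _ hc he => ⟨r.2.1, (isPermissibleCentre_iff q r.2.1 r.1.L).mpr hc, he⟩) h

/-- (1) ∧ (2) cycle ⇒ infinite HP-permissible branch. [folklore] -/
theorem exists_stepHP_chain_of_cycleB {q : ℕ} {C : List (CycRow K)} (h : cycleB (hpB q) q C = true) :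
    ∃ c : ℕ → State K, ∀ k, StepHP q (c k) (c (k + 1)) :=
  exists_chain_of_cycleB (fun r _ hc he => by
    simp only [hpB, Bool.and_eq_true] at hc
    exact ⟨r.2.1, (isPermissibleCentre_iff q r.2.1 r.1.L).mpr hc.1, (perm2_iff r.2.1 r.1).mpr hc.2, he⟩) h

/-- m1 cycle ⇒ infinite m1 branch. [folklore] -/
theorem exists_stepM1_chain_of_cycleB {q : ℕ} {C : List (CycRow K)} (h : cycleB (m1B q) q C = true) :
    ∃ c : ℕ → State K, ∀ k, StepM1 q (c k) (c (k + 1)) :=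
  exists_chain_of_cycleB (fun r _ hc he => by
    simp only [m1B, Bool.and_eq_true, decide_eq_true_eq] at hc
    exact ⟨r.2.1, (isModeM1Centre_iff q r.2.1 r.1).mpr ⟨hc.1.1, hc.1.2, hc.2⟩, he⟩) h

/-- 1h2 cycle ⇒ infinite 1h2 branch. [folklore] -/
theorem exists_step1h2_chain_of_cycleB {q : ℕ} {C : List (CycRow K)} (h : cycleB (h12B q) q C = true) :
    ∃ c : ℕ → State K, ∀ k, Step1h2 q (c k) (c (k + 1)) :=
  exists_chain_of_cycleB (fun r _ hc he => by
    simp only [h12B, Bool.and_eq_true, decide_eq_true_eq] at hc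
    exact ⟨r.2.1, (isMode1h2Centre_iff q r.2.1 r.1).mpr ⟨hc.1, hc.2.1, hc.2.2⟩, he⟩) h

/-- **A checked MODE-1h cycle over a field of characteristic `p` refutes `Terminates1h p q`.** [folklore] -/
theorem not_terminates1h_of_cycleB (p q : ℕ) [CharP K p] {C : List (CycRow K)} (h : cycleB (h1B q) q C = true) :
    ¬ Terminates1h p q := fun hT => hT K (exists_step1h_chain_of_cycleB h)

/-- A checked m1 cycle refutes `TerminatesM1 p q`. [folklore] -/
theorem not_terminatesM1_of_cycleB (p q : ℕ) [CharP K p] {C : List (CycRow K)} (h : cycleB (m1B q) q C = true) :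
    ¬ TerminatesM1 p q := fun hT => hT K (exists_stepM1_chain_of_cycleB h)

/-- A checked 1h2 cycle refutes `Terminates1h2 p q`. [folklore] -/
theorem not_terminates1h2_of_cycleB (p q : ℕ) [CharP K p] {C : List (CycRow K)} (h : cycleB (h12B q) q C = true) :
    ¬ Terminates1h2 p q := fun hT => hT K (exists_step1h2_chain_of_cycleB h)

/-! ## §14 Acceptance rows: crit-1's K-A-01 2-cycle and the C-002 3-cycle (`p = q = 2`) -/

/-- K-A-01 as two cycle rows (centres `{x₁,x₃}` / `{x₁,x₄}`, `x₁`-charts, origins). [folklore] -/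
def ka01 : List (CycRow (ZMod 2)) :=
  [(⟨[(![0, 1, 2, 2], 1), (![0, 1, 3, 1], 1), (![1, 1, 1, 3], 1)], ![0, 0, 0, 0], {0}⟩, {0, 2}, 0, ![0, 0, 0, 0]),
   (⟨[(![0, 1, 1, 3], 1), (![0, 1, 2, 2], 1), (![1, 1, 3, 1], 1)], ![0, 0, 0, 0], {0}⟩, {0, 3}, 0, ![0, 0, 0, 0])]

/-- The K-A-01 rows check in MODE 1h. -/
theorem cycleB_ka01 : cycleB (h1B 2) 2 ka01 = true := by decide

/-- C-002 as three cycle rows (LINE centres, `x₁`-charts, origins). [folklore] -/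
def c002 : List (CycRow (ZMod 2)) :=
  [(⟨[(![0, 2, 0, 1], 1), (![1, 0, 0, 3], 1), (![1, 0, 2, 1], 1)], ![0, 0, 0, 0], {0}⟩, {0, 1, 3}, 0, ![0, 0, 0, 0]),
   (⟨[(![0, 0, 2, 1], 1), (![1, 2, 0, 1], 1), (![2, 0, 0, 3], 1)], ![0, 0, 0, 0], {0}⟩, {0, 1, 2}, 0, ![0, 0, 0, 0]),
   (⟨[(![0, 0, 0, 3], 1), (![0, 0, 2, 1], 1), (![1, 2, 0, 1], 1)], ![0, 0, 0, 0], {0}⟩, {0, 2, 3}, 0, ![0, 0, 0, 0])]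

/-- The C-002 rows check in MODE 1h. -/
theorem cycleB_c002 : cycleB (h1B 2) 2 c002 = true := by decide

end StepKit

end Summit.ResolutionOfSingularities.ResolutionOfSingularities.Theorems.PIDim4

end
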